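import Summits.BirchSwinnertonDyer.BirchSwinnertonDyer.Theorems.ByReductionTypeAtTwoFineSelmerConjAAtTwoAdditivePotGoodClassNumberOne9980
import Literature.NumberTheory.NumberFields.DyadicUnitSquaresRamifiedPrime
import HarnessLib

/-!
# Route `ByReductionTypeAtTwo` (rung K4), crux C1″ `FineSelmerConjAAtTwoAdditivePotGood` (item stmt-BirchSwinnertonDyer-22615, cc C3″ 22617):
# THE CENSUS ROW `279440c1` — A CUBIC UNIT OF ITS TOTALLY REAL POINT FIELD `K = ℚ(θ)` (`θ³ − θ² − 36θ − 70 = 0`, `d = 9980`, `𝓞_K = ℤ[θ]`,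
# `2 = 𝔭²𝔮`) WHICH IS NOT A NORM FROM THE SECOND CYCLOTOMIC LAYER `K₂ = K₁(√(2+√2))` DOWN TO THE FIRST `K₁ = K(√2)` — MODEL-FREE and KERNEL
# (a `--supports 22615` file; seat `bsd-2adic-k4-w1` GEN 12; the `r = 1` input of the COINVARIANT-GENUS road
# `Literature/NumberTheory/IwasawaTheory/ClassGroupCoinvariantGenusCriterion.lean` at `n₀ = 0`: `rank₂ Cl(K₁) + t ≤ 2 + r` ⟹ classical `μ₂(K_cyc) = 0`)

HONEST FRAMING (cell `bsd-2adic`, D-0036/D-0054/D-0152): KERNEL theorems about ONE sextic extension; no elliptic curve, no named fact, no `sorry`,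
no definition.  Closes nothing at the `∀`-level (C1″ 22615 research-open); nothing booked.  For this `Δ > 0` row the road gives input (a) (classical
`μ₂ = 0` of `ℚ(θ)`) of the narrow-μ door `SteinbergFibreAtTwo.NarrowMu.conjA_two_cubicModel_of_narrowMu`, NOT its input (b) (bounded narrow defect);
BSD for `279440c1` is NOT proved by this.

MODEL-FREE: stated for ANY number field `F ⊇ K` with `[F : K] = 2` and `s ∈ F`, `s² = 2`, `K` any cubic number field containing a root `θ` of
`X³ − X² − 36X − 70`; applies verbatim to the abstract layer `κ.layer 1` of every cyclotomic `ℤ₂`-extension `κ` of `K`.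

THE ARITHMETIC (exact; seat tools `work/num2/`).  `𝓞_K = ℤ[θ]` (`|disc| = 9980`); `π_𝔭 = −8 − 3θ`, `π_𝔮 = 3 + θ` (norms `−2`; the generators of
`…ClassNumberOne9980`), `u₀ := 2/(π_𝔭²π_𝔮) = 30411 + 4270θ − 1162θ²` is a UNIT (`u₀⁻¹ = 411 + 266θ + 42θ²`).  In `F = K(s)`: `ξ := s/π_𝔭 =
s(118 + 33θ/2 − 9θ²/2)`, `ξ² = u₀π_𝔮 = 9893 + 1389θ − 378θ²`, `2 = ξ²π_𝔭²`; `ξ` is a PRIME of `𝓞 F` (`|N(ξ)|² = N(u₀π_𝔮)² = 4`) with residues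
`{0,1}`, `π_𝔭 − 1 ∈ ξ𝓞` (`e(𝔔|2) = 2`, `f = 1` at `𝔔 = (ξ)`, `F_𝔔 = ℚ₂(√2)`).  THE UNIT: `u₀ ∈ K` has `u₀(r) ≡ 11 (mod 16)` at the `𝔮`-adic root
`r` (`K_𝔮 = ℚ₂`), so `N_{F_𝔔/ℚ₂}(u₀) = u₀² ≡ 9 (mod 16)` is not a unit norm from `ℚ₂(ζ₁₆)⁺`: with the norm `n = (1+θ+θ²+ξ)² − (2+s)ξ²` from
`F(√(2+s))`, `ε₁ := u₀·n ≡ 1 + ξ⁴ (mod ξ⁵)` (`ε₁ − 1 = ξ⁴z₄`, `z₄ − 1 = ξz₅`) and `2 + s = ξμ`, `μ = π_𝔭(1+s)`, `ξ ∤ μ`; GEN 11's dyadic lemma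
`not_exists_sq_sub_mul_sq_fractionRing_of_pow_four_dvd` (O'Meara 63:10) forbids `x² − (2+s)y² = ε₁`, hence `a² − (2+s)c² = u₀`.

* `layer_one_ids_d9980` — the ring identities of `ℤ[θ, ξ]` (any commutative ring).
* `layer_one_dyadic_d9980` — `θ, ξ ∈ 𝓞 F`, `ξ² = u₀π_𝔮`, `ξπ_𝔭 = s`, `Prime ξ`, residues `{0,1}`.
* ★ `exists_unit_forall_sq_sub_mul_sq_ne_d9980` — `∃ η : (𝓞 F)ˣ, ∀ a c : F, a² − (2 + s)·c² ≠ η` (`η = u₀`).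

References: [Omeara1963] §63A–B (63:1, 63:10); [Washington1997] §13.1, §13.3 Prop. 13.22–13.23; [Gras2003] IV.4; [Cohen1993] §4.8.2, §6.3, App. B
(totally real cubics: d = 9980); [Marcus1977] Ch. 2 Thm. 4, Ch. 3 Thm. 22.
-/

set_option autoImplicit false
-- sibling precedent: the directory name repeats the summit name
set_option linter.dupNamespace false

noncomputable section

open scoped Classical NumberField nonZeroDivisors

namespace Summit.BirchSwinnertonDyer.BirchSwinnertonDyer.Theorems.AddKatoTwo

open Polynomial IsDedekindDomain NumberField Literature.NumberTheory.NumberFields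

/-! ## §1 The ring identities of `ℤ[θ, ξ]` -/

/-- **The identities of `ℤ[θ, ξ]`** (`θ³ − θ² − 36θ − 70 = 0`, `ξ² = 9893 + 1389θ − 378θ² = u₀π_𝔮`; `b, x` for `θ, ξ`) in any commutative ring:
with `π_𝔭 = −8 − 3b`, `μ = π_𝔭 + ξπ_𝔭²`, `u₀ = 30411 + 4270b − 1162b²`, `n = (1 + b + b² + ξ)² − (2 + ξπ_𝔭)ξ²` and `z, z_μ, z₄, z₅` as displayed:
`ξ²π_𝔭² = 2`; `π_𝔭 − 1 = ξz`; `μ − 1 = ξz_μ`; `ξμ = 2 + ξπ_𝔭`; `u₀u₀⁻¹ = 1`; `u₀n − 1 = ξ⁴z₄`; `z₄ − 1 = ξz₅`.  Integer `linear_combination`s found by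
exact reduction (seat `work/num2/red2.py`). [folklore] [cite: Cohen1993, §4.8.2 and §6.3] -/
theorem layer_one_ids_d9980 {R : Type*} [CommRing R] (b x : R)
    (Rb : b ^ 3 - b ^ 2 - 36 * b - 70 = 0) (Rx : x ^ 2 = 9893 + 1389 * b - 378 * b ^ 2) :
    x ^ 2 * (-8 - 3 * b) ^ 2 = 2 ∧
    (-8 - 3 * b) - 1 = x * ((-1233 : R) * x + (-798 : R) * b * x + (-126 : R) * b ^ 2 * x) ∧
    ((-8 - 3 * b) + x * (-8 - 3 * b) ^ 2) - 1 = x * ((64 : R) + (-1233 : R) * x + (48 : R) * b + (-798 : R) * b * x + (9 : R) * b ^ 2 + (-126 : R) * b ^ 2 * x) ∧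
    x * ((-8 - 3 * b) + x * (-8 - 3 * b) ^ 2) = 2 + x * (-8 - 3 * b) ∧
    (30411 + 4270 * b - 1162 * b ^ 2) * ((411 : R) + (266 : R) * b + (42 : R) * b ^ 2) = 1 ∧
    (30411 + 4270 * b - 1162 * b ^ 2) * ((1 + b + b ^ 2 + x) ^ 2 - (2 + x * (-8 - 3 * b)) * x ^ 2) - 1 = x ^ 4 * ((-1807 : R) + (724 : R) * x + (-1747 : R) * b + (367 : R) * b * x + (-401 : R) * b ^ 2 + (36 : R) * b ^ 2 * x) ∧
    ((-1807 : R) + (724 : R) * x + (-1747 : R) * b + (367 : R) * b * x + (-401 : R) * b ^ 2 + (36 : R) * b ^ 2 * x) - 1 = x * ((724 : R) + (-1408156 : R) * x + (367 : R) * b + (-920051 : R) * b * x + (36 : R) * b ^ 2 + (-147148 : R) * b ^ 2 * x) := by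
  refine ⟨?_, ?_, ?_, ?_, ?_, ?_, ?_⟩
  · linear_combination ((-9045 : R) + (-3402 : R) * b) * Rb + ((64 : R) + (48 : R) * b + (9 : R) * b ^ 2) * Rx
  · linear_combination ((-174258 : R) + (-47628 : R) * b) * Rb + ((1233 : R) + (798 : R) * b + (126 : R) * b ^ 2) * Rx
  · linear_combination ((-174258 : R) + (-47628 : R) * b) * Rb + ((1233 : R) + (798 : R) * b + (126 : R) * b ^ 2) * Rx
  · linear_combination ((-9045 : R) + (-3402 : R) * b) * Rb + ((64 : R) + (48 : R) * b + (9 : R) * b ^ 2) * Rx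
  · linear_combination ((-178556 : R) + (-48804 : R) * b) * Rb
  · linear_combination ((-2522184039 : R) + (977886001 : R) * x + (-1853710194 : R) * b + (271913290 : R) * b * x + (-114168068 : R) * b ^ 2 + (-18461520 : R) * b ^ 2 * x + (57295322 : R) * b ^ 3 + (-5143824 : R) * b ^ 3 * x) * Rb + ((17846240 : R) + (-6919244 : R) * x + (1807 : R) * x ^ 2 + (-724 : R) * x ^ 3 + (19788724 : R) * b + (-4510974 : R) * b * x + (1747 : R) * b * x ^ 2 + (-367 : R) * b * x ^ 3 + (5711792 : R) * b ^ 2 + (-588725 : R) * b ^ 2 * x + (401 : R) * b ^ 2 * x ^ 2 + (-36 : R) * b ^ 2 * x ^ 3 + (-103377 : R) * b ^ 3 + (85236 : R) * b ^ 3 * x + (-151578 : R) * b ^ 4 + (13608 : R) * b ^ 4 * x) * Rx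
  · linear_combination ((-199012650 : R) + (-55621944 : R) * b) * Rb + ((1408156 : R) + (920051 : R) * b + (147148 : R) * b ^ 2) * Rx

/-! ## §2 The integers `θ, ξ` of `F = K(√2)`, the prime `ξ`, and the non-norm unit `u₀` -/

section Field

variable (K F : Type) [Field K] [NumberField K] [Field F] [NumberField F] [Algebra K F]

/-- In a quadratic extension `F/K`, `|N_{F/ℚ}(x)| = |N_{K/ℚ}(x)|²` for `x ∈ 𝓞 K` (norm transitivity). [cite: Marcus1977, Ch. 2 Thm. 4] -/
private theorem natAbs_norm_algebraMap_sq_d9980 (h2 : Module.finrank K F = 2) (x : 𝓞 K) :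
    (Algebra.norm ℤ (algebraMap (𝓞 K) (𝓞 F) x)).natAbs = (Algebra.norm ℤ x).natAbs ^ 2 := by
  haveI : IsScalarTower ℚ K F := IsScalarTower.of_algebraMap_eq fun q => by simp only [eq_ratCast, map_ratCast]
  haveI : Module.Free K F := Module.Free.of_divisionRing _ _
  have hval : ((algebraMap (𝓞 K) (𝓞 F) x : 𝓞 F) : F) = algebraMap K F (x : K) :=
    (IsScalarTower.algebraMap_apply (𝓞 K) (𝓞 F) F x).symm.trans (IsScalarTower.algebraMap_apply (𝓞 K) K F x)
  have h1 : (Algebra.norm ℤ (algebraMap (𝓞 K) (𝓞 F) x) : ℚ) = ((Algebra.norm ℤ x) ^ 2 : ℤ) := by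
    rw [Algebra.coe_norm_int, hval, ← Algebra.norm_norm (R := ℚ) (S := K) (a := algebraMap K F (x : K)),
      Algebra.norm_algebraMap, h2, map_pow, ← Algebra.coe_norm_int]
    push_cast; ring
  have h4 : Algebra.norm ℤ (algebraMap (𝓞 K) (𝓞 F) x) = (Algebra.norm ℤ x) ^ 2 := by exact_mod_cast h1
  rw [h4, Int.natAbs_pow]

set_option maxHeartbeats 1600000 in
/-- **The integers `θ, ξ = s/π_𝔭` of `F ⊇ K ∋ θ` (`θ³ − θ² − 36θ − 70 = 0`, `[K:ℚ] = 3`, `[F:K] = 2`, `s ∈ F`, `s² = 2`)**: elements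
`bF, xF ∈ 𝓞 F` with `bF = θ`, `xF = s(118 + 33θ/2 − 9θ²/2)`, `xF² = 9893 + 1389·bF − 378·bF²` (`= u₀π_𝔮`), `xF·(−8 − 3bF) = s`; `xF` is a PRIME
ELEMENT of `𝓞 F` (`|N(ξ)| = 2`) with residues `{0, 1}`. KERNEL. [cite: Cohen1993, §4.8.2 and §6.3] [cite: Marcus1977, Ch. 3 Thm. 22] [cite: Washington1997, §13.1] -/
theorem layer_one_dyadic_d9980 (h3 : Module.finrank ℚ K = 3) (h2 : Module.finrank K F = 2) (b : 𝓞 K)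
    (hb : b ^ 3 + (-1 : ℤ) * b ^ 2 + (-36 : ℤ) * b + (-70 : ℤ) = 0) (s : F) (hs : s ^ 2 = 2) :
    ∃ bF xF : 𝓞 F,
      (bF : F) = algebraMap (𝓞 K) F b ∧ (xF : F) = s * ((118 : F) + ((33 : F) / 2) * (bF : F) + ((-9 : F) / 2) * (bF : F) ^ 2) ∧
      bF ^ 3 - bF ^ 2 - 36 * bF - 70 = 0 ∧ xF ^ 2 = 9893 + 1389 * bF - 378 * bF ^ 2 ∧
      (((xF * (-8 - 3 * bF)) : 𝓞 F) : F) = s ∧ Prime xF ∧ (∀ z : 𝓞 F, xF ∣ z ∨ xF ∣ z - 1) := by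
  haveI : IsScalarTower ℚ K F := IsScalarTower.of_algebraMap_eq fun q => by simp only [eq_ratCast, map_ratCast]
  have hirr := irreducible_cubic_d9980p
  have hb' : b ^ 3 - b ^ 2 - 36 * b - 70 = 0 := by push_cast at hb; linear_combination hb
  -- `θ ∈ F`
  obtain ⟨θ, hθdef⟩ : ∃ t : F, t = algebraMap (𝓞 K) F b := ⟨_, rfl⟩
  have hθ : θ ^ 3 - θ ^ 2 - 36 * θ - 70 = 0 := by
    have h := congrArg (algebraMap (𝓞 K) F) hb'
    rw [map_sub, map_sub, map_sub, map_mul, map_pow, map_pow, map_ofNat, map_ofNat, map_zero, ← hθdef] at h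
    exact h
  obtain ⟨bF, hbFdef⟩ : ∃ y : 𝓞 F, y = algebraMap (𝓞 K) (𝓞 F) b := ⟨_, rfl⟩
  have hbFval : algebraMap (𝓞 F) F bF = θ := by
    rw [hbFdef, hθdef, ← IsScalarTower.algebraMap_apply (𝓞 K) (𝓞 F) F b]
  have RbF : bF ^ 3 - bF ^ 2 - 36 * bF - 70 = 0 := by
    have h := congrArg (algebraMap (𝓞 K) (𝓞 F)) hb'
    rw [map_sub, map_sub, map_sub, map_mul, map_pow, map_pow, map_ofNat, map_ofNat, map_zero, ← hbFdef] at h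
    exact h
  -- `ξ = s/π_𝔭`, integral since `ξ² = u₀π_𝔮 ∈ 𝓞 K`
  obtain ⟨ξ, hξdef⟩ : ∃ t : F, t = (s * ((118 : F) + ((33 : F) / 2) * θ + ((-9 : F) / 2) * θ ^ 2)) := ⟨_, rfl⟩
  have hξsq : ξ ^ 2 = algebraMap (𝓞 F) F (algebraMap (𝓞 K) (𝓞 F) (9893 + 1389 * b - 378 * b ^ 2)) := by
    simp only [map_add, map_sub, map_mul, map_pow, map_ofNat]
    rw [← hbFdef, hbFval, hξdef]
    linear_combination (((-513 : F) / 2) + ((81 : F) / 2) * θ) * hθ + ((13924 : F) + (3894 : F) * θ + ((-3159 : F) / 4) * θ ^ 2 + ((-297 : F) / 2) * θ ^ 3 + ((81 : F) / 4) * θ ^ 4) * hs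
  have hξint : IsIntegral ℤ ξ := by
    refine IsIntegral.of_pow two_pos ?_
    rw [hξsq]
    exact NumberField.RingOfIntegers.isIntegral_coe _
  obtain ⟨xF, hxFval⟩ : ∃ y : 𝓞 F, algebraMap (𝓞 F) F y = ξ := ⟨⟨ξ, hξint⟩, rfl⟩
  have RxF : xF ^ 2 = 9893 + 1389 * bF - 378 * bF ^ 2 := by
    apply NumberField.RingOfIntegers.coe_injective
    rw [map_pow, hxFval, hξsq]
    simp only [map_add, map_sub, map_mul, map_pow, map_ofNat]
    rw [← hbFdef]
  -- `ξ · π_𝔭 = s`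
  have hSP : (((xF * (-8 - 3 * bF)) : 𝓞 F) : F) = s := by
    rw [NumberField.RingOfIntegers.coe_eq_algebraMap, map_mul, map_sub, map_neg, map_mul, map_ofNat, map_ofNat, hxFval, hbFval, hξdef]
    linear_combination (((27 : F) / 2) * s) * hθ
  -- `|N(u₀π_𝔮)| = 2` in `K`, so `|N(ξ)|² = 4` and `|N(ξ)| = 2`
  have hNq : (Algebra.norm ℤ (9893 + 1389 * b - 378 * b ^ 2 : 𝓞 K)).natAbs = 2 := by
    have hN := natAbs_norm_coords_eq_natAbs_normPoly K h3 b (p := -1) (q := -36) (r := -70) hirr hb 9893 1389 (-378)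
    have he : (((9893 : ℤ) : 𝓞 K) + ((1389 : ℤ) : 𝓞 K) * b + ((-378 : ℤ) : 𝓞 K) * b ^ 2) = 9893 + 1389 * b - 378 * b ^ 2 := by push_cast; ring
    rw [he] at hN; rw [hN]; norm_num
  have h4 : (Algebra.norm ℤ (xF ^ 2)).natAbs = 2 ^ 2 := by
    rw [RxF, show (9893 + 1389 * bF - 378 * bF ^ 2 : 𝓞 F) = algebraMap (𝓞 K) (𝓞 F) (9893 + 1389 * b - 378 * b ^ 2) by
      simp only [map_add, map_sub, map_mul, map_pow, map_ofNat]; rw [← hbFdef],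
      natAbs_norm_algebraMap_sq_d9980 K F h2, hNq]
  rw [map_pow, Int.natAbs_pow] at h4
  have hNx : (Algebra.norm ℤ xF).natAbs = 2 := Nat.pow_left_injective two_ne_zero h4
  have habs : Ideal.absNorm (Ideal.span {xF}) = 2 := by rw [Ideal.absNorm_span_singleton, hNx]
  have hP : (Ideal.span {xF}).IsPrime := Ideal.isPrime_of_irreducible_absNorm (by rw [habs]; exact Nat.prime_two)
  have hx0 : xF ≠ 0 := by
    intro h0; rw [h0, Algebra.norm_zero] at hNx; norm_num at hNx
  have hprime : Prime xF := (Ideal.span_singleton_prime hx0).mp hP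
  have hcard : Nat.card (𝓞 F ⧸ Ideal.span {xF}) = 2 := by
    rw [← Submodule.cardQuot_apply, ← Ideal.absNorm_apply, habs]
  have hres : ∀ z : 𝓞 F, xF ∣ z ∨ xF ∣ z - 1 := by
    intro z
    by_cases hz : Ideal.Quotient.mk (Ideal.span {xF}) z = 0
    · exact Or.inl (Ideal.mem_span_singleton.mp (Ideal.Quotient.eq_zero_iff_mem.mp hz))
    · right
      have h10 : (1 : 𝓞 F ⧸ Ideal.span {xF}) ≠ 0 := by
        haveI : Nontrivial (𝓞 F ⧸ Ideal.span {xF}) := Ideal.Quotient.nontrivial_iff.mpr hP.ne_top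
        exact one_ne_zero
      obtain ⟨y, -, huniq⟩ := (Nat.card_eq_two_iff' (0 : 𝓞 F ⧸ Ideal.span {xF})).mp hcard
      have h1 : Ideal.Quotient.mk (Ideal.span {xF}) z = 1 := (huniq _ hz).trans (huniq _ h10).symm
      have h0 : Ideal.Quotient.mk (Ideal.span {xF}) (z - 1) = 0 := by rw [map_sub, h1, map_one, sub_self]
      exact Ideal.mem_span_singleton.mp (Ideal.Quotient.eq_zero_iff_mem.mp h0)
  refine ⟨bF, xF, ?_, ?_, RbF, RxF, hSP, hprime, hres⟩
  · rw [NumberField.RingOfIntegers.coe_eq_algebraMap, hbFval, hθdef]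
  · rw [NumberField.RingOfIntegers.coe_eq_algebraMap, NumberField.RingOfIntegers.coe_eq_algebraMap, hxFval, hξdef, hbFval]

set_option maxHeartbeats 1600000 in
/-- ★ **A unit of `K ∋ θ` (`θ³ − θ² − 36θ − 70 = 0`) that is NOT a norm from `F(√(2+√2))` down to `F = K(√2)`**: for the unit
`u₀ = 30411 + 4270θ − 1162θ² = 2/(π_𝔭²π_𝔮)` of `𝓞 K ⊆ 𝓞 F` and ALL `a, c ∈ F`: `a² − (2 + s)·c² ≠ u₀`.  Proof: `ε₁ = u₀·((1+θ+θ²+ξ)² − (2+s)ξ²) ≡ 1 + ξ⁴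
(mod ξ⁵)` at the prime `ξ` (`e = 2`, `f = 1`, `2 = ξ²π_𝔭²`, `ξ ∤ π_𝔭`, `2 + s = ξμ`, `ξ ∤ μ`), so `x² − (2+s)y² = ε₁` is impossible
(`not_exists_sq_sub_mul_sq_fractionRing_of_pow_four_dvd`); but `a² − (2+s)c² = u₀` would give it with `x = a(1+θ+θ²+ξ) + (2+s)cξ`,
`y = aξ + c(1+θ+θ²+ξ)`.  MODEL-FREE `r = 1` input of the coinvariant-genus road for `279440c1` (at `F = κ.layer 1`; `2`-adically: `u₀(r) ≡ 11 (mod 16)`).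
[cite: Omeara1963, §63B (63:10) and §63A (63:1)] [cite: Washington1997, §13.3 Prop. 13.22–13.23] [cite: Gras2003, IV.4] -/
theorem exists_unit_forall_sq_sub_mul_sq_ne_d9980 (h3 : Module.finrank ℚ K = 3) (h2 : Module.finrank K F = 2) (b : 𝓞 K)
    (hb : b ^ 3 + (-1 : ℤ) * b ^ 2 + (-36 : ℤ) * b + (-70 : ℤ) = 0) (s : F) (hs : s ^ 2 = 2) :
    ∃ η : (𝓞 F)ˣ, ∀ a c : F, a ^ 2 - (2 + s) * c ^ 2 ≠ ((η : 𝓞 F) : F) := by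
  obtain ⟨bF, xF, -, -, RbF, RxF, hSP, hprime, hres⟩ := layer_one_dyadic_d9980 K F h3 h2 b hb s hs
  obtain ⟨htwo, hpz, hmuz, hximu, hetainv, he1, hz4⟩ := layer_one_ids_d9980 bF xF RbF RxF
  have hunit : IsUnit ((30411 + 4270 * bF - 1162 * bF ^ 2) : 𝓞 F) := IsUnit.of_mul_eq_one _ hetainv
  have hone : ∀ {y z : 𝓞 F}, y - 1 = xF * z → ¬ xF ∣ y := by
    rintro y z hyz ⟨c, hc⟩
    exact hprime.not_unit (isUnit_of_dvd_one ⟨c - z, by linear_combination hc - hyz⟩)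
  have h2' : (2 : 𝓞 F) = xF ^ 2 * (-8 - 3 * bF) ^ 2 := htwo.symm
  have hw : ¬ xF ∣ (-8 - 3 * bF) ^ 2 := fun h => hone hpz (hprime.dvd_of_dvd_pow h)
  have hμ : ¬ xF ∣ ((-8 - 3 * bF) + xF * (-8 - 3 * bF) ^ 2) := hone hmuz
  have h4 : xF ^ 4 ∣ (30411 + 4270 * bF - 1162 * bF ^ 2) * ((1 + bF + bF ^ 2 + xF) ^ 2 - (2 + xF * (-8 - 3 * bF)) * xF ^ 2) - 1 := ⟨_, he1⟩
  have h5 : ¬ xF ^ 5 ∣ (30411 + 4270 * bF - 1162 * bF ^ 2) * ((1 + bF + bF ^ 2 + xF) ^ 2 - (2 + xF * (-8 - 3 * bF)) * xF ^ 2) - 1 := by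
    rintro ⟨c, hc⟩
    rw [he1] at hc
    have hx0 : xF ^ 4 ≠ 0 := pow_ne_zero 4 hprime.ne_zero
    have hdiv : xF ∣ ((-1807 : 𝓞 F) + (724 : 𝓞 F) * xF + (-1747 : 𝓞 F) * bF + (367 : 𝓞 F) * bF * xF + (-401 : 𝓞 F) * bF ^ 2 + (36 : 𝓞 F) * bF ^ 2 * xF) :=
      ⟨c, mul_left_cancel₀ hx0 (by linear_combination hc)⟩
    exact hone hz4 hdiv
  have key := not_exists_sq_sub_mul_sq_fractionRing_of_pow_four_dvd F hprime h2' hw hres hμ h4 h5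
  -- values in `F`
  rw [NumberField.RingOfIntegers.coe_eq_algebraMap] at hSP
  simp only [map_mul, map_sub, map_neg, map_ofNat] at hSP
  have hα := congrArg (algebraMap (𝓞 F) F) hximu
  simp only [map_mul, map_add, map_sub, map_neg, map_pow, map_ofNat] at hα
  refine ⟨hunit.unit, fun a c hac => key ⟨a * algebraMap (𝓞 F) F (1 + bF + bF ^ 2 + xF) + (2 + s) * c * algebraMap (𝓞 F) F xF,
    a * algebraMap (𝓞 F) F xF + c * algebraMap (𝓞 F) F (1 + bF + bF ^ 2 + xF), ?_⟩⟩
  rw [IsUnit.unit_spec, NumberField.RingOfIntegers.coe_eq_algebraMap] at hac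
  simp only [map_add, map_sub, map_mul, map_pow, map_ofNat] at hac
  simp only [map_mul, map_add, map_sub, map_neg, map_pow, map_one, map_ofNat]
  linear_combination ((1 + algebraMap (𝓞 F) F bF + algebraMap (𝓞 F) F bF ^ 2 + algebraMap (𝓞 F) F xF) ^ 2 - (2 + s) * algebraMap (𝓞 F) F xF ^ 2) * hac +
    ((30411 + 4270 * algebraMap (𝓞 F) F bF - 1162 * algebraMap (𝓞 F) F bF ^ 2) * algebraMap (𝓞 F) F xF ^ 2 - (a * algebraMap (𝓞 F) F xF + c * (1 + algebraMap (𝓞 F) F bF + algebraMap (𝓞 F) F bF ^ 2 + algebraMap (𝓞 F) F xF)) ^ 2) * hSP +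
    (-((a * algebraMap (𝓞 F) F xF + c * (1 + algebraMap (𝓞 F) F bF + algebraMap (𝓞 F) F bF ^ 2 + algebraMap (𝓞 F) F xF)) ^ 2)) * hα

end Field

end Summit.BirchSwinnertonDyer.BirchSwinnertonDyer.Theorems.AddKatoTwo

end
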